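import Literature.AlgebraicGeometry.Frobenioids.BirationalNormalizationExampleClauses
import Literature.AlgebraicGeometry.Frobenioids.BirationalizationBiratData
import Literature.AlgebraicGeometry.Frobenioids.BaseIdentityPreStepsSlim
import HarnessLib

/-!
# Frobenioids I, Example 4.6: "`C` is of [strictly] rational type" — PROVED

Mochizuki, *The geometry of Frobenioids I: the general theory*, Kyushu J. Math. **62** (2008)
293–400, kurims text p. 87 [cite: MochizukiFrdI2008, Ex. 4.6 p.87]: "Now observe that `C` is of [strictly]
rational type [cf. Definition 4.5, (ii)]". PROOF-ONLY; sequel of `BirationalNormalizationExampleClauses.lean`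
(seat abc-iut-L1-t8), in seat abc-iut-L1-t3's Def. 4.5 (ii) vocabulary `PreFrobenioidData.IsStrictlyRational`
/ `IsRational` AT THE birationalization datum `PreFrobenioid.biratData hF hsq` of seat abc-iut-L6-t6 (whose
`Φ^birat` is the concrete rational-function subfunctor `biratSubgroup`, seat abc-iut-L1-t5) — the same shape in
which [FrdI] Thm. 6.4 (i) "rational type" was proved for `C_{K/F}` (`isStrictlyRational_arith`): for ANY support
predicate `Supp` obeying the support axiom (`𝔭 ∈ Supp(a)` iff some primary element of the class `𝔭` is `≼ a`).

Content: the primary elements of `Φ(A) = ℤ_{≥0} × ℤ_{≥0}` are those with exactly one non-zero coordinate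
(`isPrimary_iff`), so `Prime(Φ(A)) = {𝔭₁, 𝔭₂}`; the element `(1,0) − (0,1) ∈ Φ^birat(A)` is the divisor of the
birational unit `[(0,1,0,1) ; (0,0,1,1)]` (`of_one_zero_div_mem_biratSubgroup`, via seat abc-iut-L1-t5's
`div_invDiv_mem_biratSubfunctor`); whence every `A_n` is strictly rational (`isStrictlyRational`) and rational
(`isRational`). Not here: "every object of `(C^un-tr)^birat` is Frobenius-compact".
No statement of the paper is strengthened; nothing here takes a side on [IUTchIII] Cor. 3.12.
-/

namespace Literature.AlgebraicGeometry.Frobenioids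

open CategoryTheory Opposite

namespace Ex46

open PreFrobenioid

variable {G : Type} [AddCommGroup G] (P : Datum G)

/-! ### Primary elements and primes of `ℤ_{≥0} × ℤ_{≥0}` -/

/-- Divisibility in `ℤ_{≥0}²` is componentwise `≤`. [cite: MochizukiFrdI2008, §0 p.12] -/
theorem dvd_iff_le (x y : Multiplicative (ℕ × ℕ)) :
    x ∣ y ↔ (Multiplicative.toAdd x).1 ≤ (Multiplicative.toAdd y).1 ∧ (Multiplicative.toAdd x).2 ≤ (Multiplicative.toAdd y).2 := by
  constructor
  · rintro ⟨c, rfl⟩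
    rw [toAdd_mul]
    exact ⟨Nat.le_add_right _ _, Nat.le_add_right _ _⟩
  · rintro ⟨h1, h2⟩
    refine ⟨Multiplicative.ofAdd ((Multiplicative.toAdd y).1 - (Multiplicative.toAdd x).1,
      (Multiplicative.toAdd y).2 - (Multiplicative.toAdd x).2), Multiplicative.toAdd.injective ?_⟩
    rw [toAdd_mul, toAdd_ofAdd]
    exact Prod.ext (by simp only [Prod.fst_add]; omega) (by simp only [Prod.snd_add]; omega)

/-- `x ≼ y` in `ℤ_{≥0}²` iff `supp x ⊆ supp y` (a zero coordinate of `y` is a zero coordinate of `x`).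
[cite: MochizukiFrdI2008, §0 p.12] -/
theorem precsim_iff (x y : Multiplicative (ℕ × ℕ)) :
    Precsim x y ↔ ((Multiplicative.toAdd y).1 = 0 → (Multiplicative.toAdd x).1 = 0) ∧
      ((Multiplicative.toAdd y).2 = 0 → (Multiplicative.toAdd x).2 = 0) := by
  constructor
  · rintro ⟨n, hn, hdvd⟩
    rw [dvd_iff_le, toAdd_pow, Prod.smul_fst, Prod.smul_snd, smul_eq_mul, smul_eq_mul] at hdvd
    constructor
    · intro h; rw [h, mul_zero] at hdvd; omega
    · intro h; rw [h, mul_zero] at hdvd; omega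
  · rintro ⟨h1, h2⟩
    refine ⟨(Multiplicative.toAdd x).1 + (Multiplicative.toAdd x).2 + 1, by omega, ?_⟩
    rw [dvd_iff_le, toAdd_pow, Prod.smul_fst, Prod.smul_snd, smul_eq_mul, smul_eq_mul]
    constructor
    · rcases Nat.eq_zero_or_pos (Multiplicative.toAdd y).1 with h | h
      · rw [h1 h]; exact Nat.zero_le _
      · nlinarith
    · rcases Nat.eq_zero_or_pos (Multiplicative.toAdd y).2 with h | h
      · rw [h2 h]; exact Nat.zero_le _
      · nlinarith

/-- `x = 1` in `ℤ_{≥0}²` iff both coordinates vanish. [cite: MochizukiFrdI2008, §0 p.12] -/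
theorem eq_one_iff (x : Multiplicative (ℕ × ℕ)) : x = 1 ↔ (Multiplicative.toAdd x).1 = 0 ∧ (Multiplicative.toAdd x).2 = 0 := by
  rw [← toAdd_eq_zero]
  exact ⟨fun h => ⟨by rw [h]; rfl, by rw [h]; rfl⟩, fun h => Prod.ext h.1 h.2⟩

/-- **The primary elements of `ℤ_{≥0}²`** are those with exactly one non-zero coordinate.
[cite: MochizukiFrdI2008, §0 p.12] -/
theorem isPrimary_iff (x : Multiplicative (ℕ × ℕ)) :
    IsPrimary x ↔ ((Multiplicative.toAdd x).1 ≠ 0 ∧ (Multiplicative.toAdd x).2 = 0) ∨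
      ((Multiplicative.toAdd x).1 = 0 ∧ (Multiplicative.toAdd x).2 ≠ 0) := by
  constructor
  · rintro ⟨hx, hmin⟩
    rw [Ne, eq_one_iff] at hx
    by_cases h1 : (Multiplicative.toAdd x).1 = 0
    · exact Or.inr ⟨h1, fun h2 => hx ⟨h1, h2⟩⟩
    · by_cases h2 : (Multiplicative.toAdd x).2 = 0
      · exact Or.inl ⟨h1, h2⟩
      · -- both coordinates non-zero: `(1, 0) ≼ x` but `x ⋠ (1, 0)`
        exfalso
        have hb : Precsim (Multiplicative.ofAdd ((1 : ℕ), (0 : ℕ))) x :=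
          (precsim_iff _ _).mpr ⟨fun h => absurd h h1, fun _ => rfl⟩
        have hne : Multiplicative.ofAdd ((1 : ℕ), (0 : ℕ)) ≠ (1 : Multiplicative (ℕ × ℕ)) := by
          rw [Ne, eq_one_iff]; simp
        have := ((precsim_iff _ _).mp (hmin _ hne hb)).2 rfl
        exact h2 this
  · intro h
    refine ⟨fun h1 => ?_, fun b hb hbx => ?_⟩
    · rw [eq_one_iff] at h1
      rcases h with ⟨h, -⟩ | ⟨-, h⟩
      · exact h h1.1
      · exact h h1.2
    · rw [Ne, eq_one_iff] at hb
      obtain ⟨hb1, hb2⟩ := (precsim_iff _ _).mp hbx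
      refine (precsim_iff _ _).mpr ⟨fun hb1' => ?_, fun hb2' => ?_⟩
      · rcases h with ⟨hx1, hx2⟩ | ⟨hx1, _⟩
        · exact absurd ⟨hb1', hb2 hx2⟩ hb
        · exact hx1
      · rcases h with ⟨_, hx2⟩ | ⟨hx1, hx2⟩
        · exact hx2
        · exact absurd ⟨hb1 hx1, hb2'⟩ hb

/-! ### The germ `(1,0) − (0,1) ∈ Φ^birat(A)` -/

/-- The element `(1, 0) − (0, 1)` of `Φ(A)^gp = ℤ²` lies in `Φ^birat(A)`: it is the divisor of the birational unit
given by the pair of pre-steps `(0,1,0,1), (0,0,1,1) : A_{n−1} ⇉ A_n`. [cite: MochizukiFrdI2008, Ex. 4.6 p.87] -/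
theorem of_one_zero_div_mem_biratSubgroup (A : Obj P) :
    Algebra.GrothendieckGroup.of (Multiplicative.ofAdd (((1 : ℕ), (0 : ℕ))) : Multiplicative (ℕ × ℕ)) /
        Algebra.GrothendieckGroup.of (Multiplicative.ofAdd (((0 : ℕ), (1 : ℕ))) : Multiplicative (ℕ × ℕ)) ∈
      biratSubgroup (toElem P) (baseObj (toElem P) A) := by
  let E : Obj P := ⟨A.idx - 1⟩
  obtain ⟨δ₁, h₁⟩ := exists_hom P E A 0 1 0 1 zero_le_one le_rfl (by simp [E])
  obtain ⟨δ₂, h₂⟩ := exists_hom P E A 0 0 1 1 le_rfl zero_le_one (by simp [E])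
  have hδ₁ : IsCoAngularPreStep (toElem P) δ₁ := (isCoAngularPreStep_iff P δ₁).mpr (by rw [h₁])
  have hδ₂ : IsPreStep (toElem P) δ₂ := (isPreStep_iff P δ₂).mpr (by rw [h₂])
  have key := div_invDiv_mem_biratSubfunctor (toElem P) δ₁ δ₂ hδ₁ hδ₂ (Subsingleton.elim _ _)
  rw [invDiv_eq, invDiv_eq, div_eq, div_eq, h₁, h₂] at key
  exact key

/-! ### Strict rationality -/

/-- **Example 4.6: "`C` is of [strictly] rational type"** (FrdI p. 87) — PROVED at THE birationalization
(`PreFrobenioid.biratData`, Def. 4.5 (ii) as `PreFrobenioidData.IsStrictlyRational`) for any support predicate obeying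
the support axiom: for the prime of `(k, 0)` take `a = (1,0)`, `b = (0,1)` (`a − b ∈ Φ^birat`, `𝔭 ∈ Supp(a)`,
`𝔭 ∉ Supp(b)`), and symmetrically. [cite: MochizukiFrdI2008, Ex. 4.6 p.87] -/
theorem isStrictlyRational (hF : IsFrobenioid (toElem P)) (hsq : HasBiratSquares (toElem P))
    (Supp : ∀ {X : Discrete PUnit.{1}}, (PreFrobenioidData.ofFunctor Φ (toElem P)).Mon X →
      Primes ((PreFrobenioidData.ofFunctor Φ (toElem P)).Mon X) → Prop)
    (hSupp : ∀ (X : Discrete PUnit.{1}) (a : Multiplicative (ℕ × ℕ)) (𝔭 : Primes (Multiplicative (ℕ × ℕ))),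
      Supp (X := X) a 𝔭 ↔ ∃ (a₀ : Multiplicative (ℕ × ℕ)) (h₀ : IsPrimary a₀),
        Quotient.mk (primarySetoid _) ⟨a₀, h₀⟩ = 𝔭 ∧ Precsim a₀ a)
    (A : Obj P) :
    PreFrobenioidData.IsStrictlyRational (PreFrobenioid.biratData hF hsq) Supp A := by
  intro 𝔭
  obtain ⟨⟨a₀, ha₀⟩, rfl⟩ := Quotient.exists_rep 𝔭
  have hmem := of_one_zero_div_mem_biratSubgroup P A
  -- the two primes
  rcases (isPrimary_iff a₀).mp ha₀ with ⟨h1, h2⟩ | ⟨h1, h2⟩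
  · refine ⟨Multiplicative.ofAdd (((1 : ℕ), (0 : ℕ))), Multiplicative.ofAdd (((0 : ℕ), (1 : ℕ))), hmem, ?_, ?_⟩
    · exact (hSupp _ _ _).mpr ⟨a₀, ha₀, rfl, (precsim_iff _ _).mpr ⟨fun h => absurd h one_ne_zero, fun _ => h2⟩⟩
    · rintro hS
      obtain ⟨a₁, ha₁, hrep, hprec⟩ := (hSupp _ _ _).mp hS
      have h10 : Precsim a₁ a₀ := Quotient.exact hrep
      have e1 : (Multiplicative.toAdd a₁).1 = 0 := ((precsim_iff _ _).mp hprec).1 rfl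
      have e2 : (Multiplicative.toAdd a₁).2 = 0 := ((precsim_iff _ _).mp h10).2 h2
      exact ha₁.1 ((eq_one_iff a₁).mpr ⟨e1, e2⟩)
  · refine ⟨Multiplicative.ofAdd (((0 : ℕ), (1 : ℕ))), Multiplicative.ofAdd (((1 : ℕ), (0 : ℕ))), ?_, ?_, ?_⟩
    · exact (Subgroup.div_mem_comm_iff _).mp hmem
    · exact (hSupp _ _ _).mpr ⟨a₀, ha₀, rfl, (precsim_iff _ _).mpr ⟨fun _ => h1, fun h => absurd h one_ne_zero⟩⟩
    · rintro hS
      obtain ⟨a₁, ha₁, hrep, hprec⟩ := (hSupp _ _ _).mp hS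
      have h10 : Precsim a₁ a₀ := Quotient.exact hrep
      have e2 : (Multiplicative.toAdd a₁).2 = 0 := ((precsim_iff _ _).mp hprec).2 rfl
      have e1 : (Multiplicative.toAdd a₁).1 = 0 := ((precsim_iff _ _).mp h10).1 h1
      exact ha₁.1 ((eq_one_iff a₁).mpr ⟨e1, e2⟩)

/-- Hence every object of `C` is rational (Def. 4.5 (ii): a pull-back morphism from a strictly rational object
— the identity). [cite: MochizukiFrdI2008, Ex. 4.6 p.87] -/
theorem isRational (hF : IsFrobenioid (toElem P)) (hsq : HasBiratSquares (toElem P))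
    (Supp : ∀ {X : Discrete PUnit.{1}}, (PreFrobenioidData.ofFunctor Φ (toElem P)).Mon X →
      Primes ((PreFrobenioidData.ofFunctor Φ (toElem P)).Mon X) → Prop)
    (hSupp : ∀ (X : Discrete PUnit.{1}) (a : Multiplicative (ℕ × ℕ)) (𝔭 : Primes (Multiplicative (ℕ × ℕ))),
      Supp (X := X) a 𝔭 ↔ ∃ (a₀ : Multiplicative (ℕ × ℕ)) (h₀ : IsPrimary a₀),
        Quotient.mk (primarySetoid _) ⟨a₀, h₀⟩ = 𝔭 ∧ Precsim a₀ a)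
    (A : Obj P) :
    PreFrobenioidData.IsRational (PreFrobenioid.biratData hF hsq) Supp A :=
  ⟨A, 𝟙 A, PreFrobenioidData.isPullbackMorphism_id _ A, isStrictlyRational P hF hsq Supp hSupp A⟩

end Ex46

end Literature.AlgebraicGeometry.Frobenioids
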